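/-
Copyright (c) 2026 the pub-hodgecm-mathlib formalisation cell (harness21).  Prover seat hodgecm-mathlib-F0P2-p02 (g12), 2026-09-01.  Road «S3-tree» (architect A-p16 (g30)
A-160∕A-170), the LIFT `_le_one ↦ _le_two`, organ (I) `stub_liftInterior`, N6 — the TYPE-(1) `hZ` binder of ★ N3 `classOrbitalIntegral_levelOneIndicator_eq_shift` and of
★ trunk #1 `finsum_delta_mul_classOrbitalIntegral_levelOneIndicator_eq_inv_sq_mul_shift`.
-/
import Literature.NumberTheory.Rogawski1990.UnitFundamentalLemmaInertFlickerRepresentatives   -- ★ `endoEmbLocal_mul_endoGL_frame`; brings ★ (E1) `exists_eigenframe_cmDatum_local_of_isRoot_map_of_separable`, ★ `conjLocal_finGammaTwo_mul_finGammaTwo`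
import Literature.NumberTheory.Rogawski1990.LocalHyperbolicClassIsLevi                       -- ★ `forall_conjLocal_mul_eq_one_of_not_exists_conj_glDiagonal`
import Literature.NumberTheory.Automorphic.UnitaryEllipticCentralizerCompactNonsplit           -- ★ `compactSpace_centralizer_of_eigenframe_of_smul_eq`
import Literature.NumberTheory.Rogawski1990.FinExplicitTransferFactorTorusDockSplit            -- ★ `eval_finCharpolyTwo_eq_of_frame`
import Literature.NumberTheory.Rogawski1990.FinExplicitTransferFactorNondegenerate             -- ★ `isUnit_eval_finCharpolyTwo_of_isLocalGRegular`
import Literature.NumberTheory.Rogawski1990.LocalCentralizerTorusMeasureCM                     -- ★ `isRegularElt_fst_snd_of_isLocalGRegular`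
import HarnessLib

/-!
# Type (1): every match of a non-Levi `G`-regular `γ_H` whose `χ_{g_w}` splits has compact centraliser in `G′_v`
# (Rogawski 1990 §4.9 Prop. 4.9.1 (a); Flicker 1998 §2 Prop. 3)

Topic `NumberTheory/Rogawski1990`; namespace `Literature.NumberTheory.Rogawski1990`.  THEOREMS ONLY (no definition, no instance, no notation, no named fact, no `sorry`); kernel lane
`--supports stmt-HodgeConjecture-24833`.  Cell `pub/hodgecm-mathlib` (D-0151), crux H413; road «S3-tree», the LIFT `_le_one ↦ _le_two`, organ (I) `stub_liftInterior`, N6: the TYPE-(1)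
twin of ★ `compactSpace_centralizer_of_isLocalNormPair_of_not_exists_isRoot` (type (2)) — the `hZ` binder of ★ N3 `classOrbitalIntegral_levelOneIndicator_eq_shift` (F0P2-p01 (g14),
p846692) and of ★ trunk #1 (F0P3a-p06 (g14), p846706) for the type-(1) branch (companion of ★∕filed `LevelTwoLiftInteriorTypeOne`, this seat).
HONEST LABEL: HC_CM is proved only modulo the 2 remaining named inputs (hLiu418 24832, h413 24833) until rung 0 closes; nothing printed is asserted here.

THE MATHEMATICS.  `v` non-split (`σ • w = w`), `H′` hermitian invertible, `γ_H = (g, u) ∈ H_v` `G`-regular, NOT `H_v`-conjugate to a diagonal torus element, with `χ_{g_w}` split over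
`L_w`.  Then `g` has an eigenframe `g P = P diag(u₀, u₁)` over `E_v` (★ (E1)) whose eigenvalues have norm one (non-Levi ⇒ the torus is `E¹ × E¹`, ★
`forall_conjLocal_mul_eq_one_of_not_exists_conj_glDiagonal`), so `ι_v(γ_H) · ι(P, 1) = ι(P, 1) · diag(u₀, γ₂, u₁)` (★ `endoEmbLocal_mul_endoGL_frame`) with `u₀, γ₂, u₁` pairwise distinct
(`G`-regularity: `χ_g(γ₂) = (γ₂ − u₀)(γ₂ − u₁)` is a unit) of norm one; a match `x ↔ γ_H` is `x = T ι_v(γ_H) T⁻¹` in `GL₃(E_v)`, so `x · (T ι(P,1)) = (T ι(P,1)) · diag(u₀, γ₂, u₁)` and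
`Z_{G′_v}(x) ≅ (L_w¹)³` is compact (★ `compactSpace_centralizer_of_eigenframe_of_smul_eq`).

## References
* [Rogawski1990] J. D. Rogawski, *Automorphic Representations of Unitary Groups in Three Variables*, Ann. of Math. Stud. 123 (1990), §4.9 Prop. 4.9.1 (a) p. 55; §3.6 p. 31;
  §4.3 (4.3.1) p. 43; §14.1 p. 232.
* [Flicker1998UnitaryFL] Y. Z. Flicker, *Elementary proof of the fundamental lemma for a unitary group*, Canad. J. Math. 50 (1998), §2 Prop. 3 p. 78.
-/

set_option autoImplicit false

noncomputable section

open NumberField IsDedekindDomain Matrix Polynomial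
open scoped MatrixGroups

namespace Literature.NumberTheory.Rogawski1990

open Literature.NumberTheory.Automorphic Literature.NumberTheory.Automorphic.UnitaryGroup
open Literature.NumberTheory.GaloisRepresentations Literature.NumberTheory.NumberFields

variable (L : Type) [Field L] [NumberField L] [IsCMField L] (v : HeightOneSpectrum (𝓞 ↥(maximalRealSubfield L)))
  (H' : Matrix (Fin 3) (Fin 3) L) (w : PlacesOver L v) (hw : IsCMField.complexConj L • w.1 = w.1)

/-- `![a, b, d]` is injective for pairwise distinct `a, b, d`. [folklore] -/
private theorem injective_vecThree {α : Type*} {a b d : α} (hab : a ≠ b) (hbd : b ≠ d) (had : a ≠ d) : Function.Injective ![a, b, d] := by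
  intro i j hij
  fin_cases i <;> fin_cases j
  all_goals first | rfl | (exfalso; revert hij; simp [hab, hbd, had, hab.symm, hbd.symm, had.symm])

include hw in
set_option maxHeartbeats 800000 in
-- the carriers' types are large
/-- **A NORM-ONE EIGENFRAME OF EVERY MATCH (type (1), non-Levi).**  For `γ_H` `G`-regular, not `H_v`-conjugate to a diagonal torus element, with `χ_{g_w}` split, and `x ↔ γ_H`
in `G′_v = U(H′)(L⁺_v)`: `x · Q = Q · diag(u)` for some `Q ∈ GL₃(E_v)` and pairwise distinct `u_i` with `σ(u_i) u_i = 1`.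
[cite: Rogawski1990, §4.9 Prop. 4.9.1 (a) p. 55; §3.6 p. 31; §14.1 p. 232] [cite: Flicker1998UnitaryFL, §2 Prop. 3 p. 78] -/
theorem exists_normOne_eigenframe_of_isLocalNormPair_of_isRoot
    {γH : (cmDatum L 2 (Matrix.of fun i j : Fin 2 => if i.val + j.val + 1 = 2 then (1 : L) else 0)).Local v ×
      (cmDatum L 1 (Matrix.of fun i j : Fin 1 => if i.val + j.val + 1 = 1 then (1 : L) else 0)).Local v}
    (hreg : IsLocalGRegular L v γH)
    (hsplit : ∃ x : w.1.adicCompletion L, (((γH.1.val : GL (Fin 2) (LocalRing L v)).val.map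
        (Pi.evalRingHom (fun w' : PlacesOver L v => w'.1.adicCompletion L) w)).charpoly).IsRoot x)
    (hell : ¬ ∃ (y : ((cmDatum L 2 (Matrix.of fun i j : Fin 2 => if i.val + j.val + 1 = 2 then (1 : L) else 0)).Local v ×
        (cmDatum L 1 (Matrix.of fun i j : Fin 1 => if i.val + j.val + 1 = 1 then (1 : L) else 0)).Local v)) (d' : Fin 2 → (UnitaryGroup.LocalRing L v)ˣ),
        glDiagonal 2 (UnitaryGroup.LocalRing L v) d' = ((y * γH * y⁻¹).1.val : GL (Fin 2) (UnitaryGroup.LocalRing L v)))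
    (x : (cmDatum L 3 H').Local v) (hx : IsLocalNormPair L H' v γH x) :
    ∃ (Q : GL (Fin 3) (LocalRing L v)) (u : Fin 3 → LocalRing L v),
      (x.val.val : Matrix (Fin 3) (Fin 3) (LocalRing L v)) * Q.val = Q.val * diagonal u ∧ Function.Injective u ∧
        ∀ i, conjLocal L (IsCMField.complexConj L) v (u i) * u i = 1 := by
  set evw : LocalRing L v →+* w.1.adicCompletion L := Pi.evalRingHom (fun w' : PlacesOver L v => w'.1.adicCompletion L) w with hevw
  -- an eigenframe of `g` over `E_v` with norm-one eigenvalues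
  have hsep : (((γH.1.val : GL (Fin 2) (LocalRing L v)) : Matrix (Fin 2) (Fin 2) (LocalRing L v)).charpoly).Separable :=
    (isRegularElt_fst_snd_of_isLocalGRegular L v γH hreg).1
  obtain ⟨α, hα⟩ := hsplit
  have hcm : (((γH.1.val : GL (Fin 2) (LocalRing L v)).val.map evw).charpoly) =
      ((((γH.1.val : GL (Fin 2) (LocalRing L v)) : Matrix (Fin 2) (Fin 2) (LocalRing L v)).charpoly).map evw) := Matrix.charpoly_map _ _
  rw [hcm] at hα
  obtain ⟨P, u, hP, hu, -⟩ := exists_eigenframe_cmDatum_local_of_isRoot_map_of_separable L v w hw γH.1 hα hsep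
  have hu1 : ∀ i, conjLocal L (IsCMField.complexConj L) v (u i) * u i = 1 :=
    forall_conjLocal_mul_eq_one_of_not_exists_conj_glDiagonal L v w hw hP hu hell
  have hbb : conjLocal L (IsCMField.complexConj L) v (finGammaTwo L v γH) * finGammaTwo L v γH = 1 := conjLocal_finGammaTwo_mul_finGammaTwo L v γH
  -- the frame of `ι_v(γ_H)`
  have hP' : (γH.1.val.val : Matrix (Fin 2) (Fin 2) (LocalRing L v)) * P.val = P.val * diagonal ![u 0, u 1] := by
    have e : diagonal u = diagonal ![u 0, u 1] := congrArg diagonal (by ext i; fin_cases i <;> rfl)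
    rw [← e]; exact hP
  have hDa : ((P⁻¹ * (γH.1.val : GL (Fin 2) (LocalRing L v)) * P : GL (Fin 2) (LocalRing L v)).val : Matrix (Fin 2) (Fin 2) (LocalRing L v)) = diagonal ![u 0, u 1] := by
    rw [Units.val_mul, Units.val_mul, Matrix.mul_assoc]
    change (P⁻¹).val * ((γH.1.val.val : Matrix (Fin 2) (Fin 2) (LocalRing L v)) * P.val) = _
    rw [hP', ← Matrix.mul_assoc, ← Units.val_mul, inv_mul_cancel, Units.val_one, Matrix.one_mul]
  have hι := endoEmbLocal_mul_endoGL_frame L (γH := γH) (P₂ := P) (Da := P⁻¹ * (γH.1.val : GL (Fin 2) (LocalRing L v)) * P) hDa hP'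
  -- the match `x = T ι_v(γ_H) T⁻¹`
  obtain ⟨T, hT⟩ := isConj_iff.1 ((isLocalNormPair_iff (L := L) (H' := H') (v := v) _ _).1 hx)
  have hx' : (x.val.val : Matrix (Fin 3) (Fin 3) (LocalRing L v)) =
      T.val * (((endoEmbLocal L v γH).val : GL (Fin 3) (LocalRing L v)).val : Matrix (Fin 3) (Fin 3) (LocalRing L v)) * (T⁻¹).val := by
    rw [← Units.val_mul, ← Units.val_mul, hT]
  refine ⟨T * endoGL (P, (1 : GL (Fin 1) (LocalRing L v))), ![u 0, finGammaTwo L v γH, u 1], ?_, ?_, ?_⟩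
  · calc (x.val.val : Matrix (Fin 3) (Fin 3) (LocalRing L v)) * (T * endoGL (P, (1 : GL (Fin 1) (LocalRing L v)))).val
        = T.val * ((((endoEmbLocal L v γH).val : GL (Fin 3) (LocalRing L v)).val : Matrix (Fin 3) (Fin 3) (LocalRing L v)) *
            ((T⁻¹).val * T.val) * (endoGL (P, (1 : GL (Fin 1) (LocalRing L v)))).val) := by
          rw [hx', Units.val_mul]; simp only [Matrix.mul_assoc]
      _ = T.val * ((endoGL (P, (1 : GL (Fin 1) (LocalRing L v)))).val * diagonal ![u 0, finGammaTwo L v γH, u 1]) := by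
          rw [← Units.val_mul, inv_mul_cancel, Units.val_one, Matrix.mul_one, hι]
      _ = (T * endoGL (P, (1 : GL (Fin 1) (LocalRing L v)))).val * diagonal ![u 0, finGammaTwo L v γH, u 1] := by
          rw [Units.val_mul, Matrix.mul_assoc]
  · -- pairwise distinct: `u₀ ≠ u₁` (the frame) and `γ₂ ∉ {u₀, u₁}` (`χ_g(γ₂)` is a unit)
    have hχ : IsUnit ((finCharpolyTwo L v γH).eval (finGammaTwo L v γH)) := isUnit_eval_finCharpolyTwo_of_isLocalGRegular L v γH hreg
    have heval := eval_finCharpolyTwo_eq_of_frame (L := L) (v := v) P hP'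
    have h0 : u 0 ≠ finGammaTwo L v γH := fun h => by
      rw [heval, ← h, sub_self, zero_mul] at hχ; exact not_isUnit_zero hχ
    have h1 : finGammaTwo L v γH ≠ u 1 := fun h => by
      rw [heval, h, sub_self, mul_zero] at hχ; exact not_isUnit_zero hχ
    have h01 : u 0 ≠ u 1 := fun h => absurd (hu h) (by decide)
    exact injective_vecThree h0 h1 h01
  · intro i
    fin_cases i
    · exact hu1 0
    · exact hbb
    · exact hu1 1

include hw in
set_option maxHeartbeats 800000 in
-- the carriers' types are large
/-- **COMPACT CENTRALISERS OF THE MATCHES, TYPE (1)** (the `hZ` binder of ★ N3 `classOrbitalIntegral_levelOneIndicator_eq_shift` and of ★ trunk #1 for the type-(1) branch; twin of ★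
`compactSpace_centralizer_of_isLocalNormPair_of_not_exists_isRoot`): for `H′` hermitian with `det H′ ≠ 0`, `γ_H` `G`-regular non-Levi with `χ_{g_w}` split, and `x ↔ γ_H` in
`G′_v`, the centraliser `Z_{G′_v}(x)` is compact (it is the norm-one torus `(L_w¹)³` in the eigenframe above, ★ `compactSpace_centralizer_of_eigenframe_of_smul_eq`).
[cite: Rogawski1990, §4.9 Prop. 4.9.1 (a) p. 55; §4.3 (4.3.1) p. 43] [cite: Flicker1998UnitaryFL, §2 Prop. 3 p. 78] -/
theorem compactSpace_centralizer_of_isLocalNormPair_of_isRoot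
    (hH' : (H'.map (cmConjRingHom L)).transpose = H') (hdet : H'.det ≠ 0)
    {γH : (cmDatum L 2 (Matrix.of fun i j : Fin 2 => if i.val + j.val + 1 = 2 then (1 : L) else 0)).Local v ×
      (cmDatum L 1 (Matrix.of fun i j : Fin 1 => if i.val + j.val + 1 = 1 then (1 : L) else 0)).Local v}
    (hreg : IsLocalGRegular L v γH)
    (hsplit : ∃ x : w.1.adicCompletion L, (((γH.1.val : GL (Fin 2) (LocalRing L v)).val.map
        (Pi.evalRingHom (fun w' : PlacesOver L v => w'.1.adicCompletion L) w)).charpoly).IsRoot x)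
    (hell : ¬ ∃ (y : ((cmDatum L 2 (Matrix.of fun i j : Fin 2 => if i.val + j.val + 1 = 2 then (1 : L) else 0)).Local v ×
        (cmDatum L 1 (Matrix.of fun i j : Fin 1 => if i.val + j.val + 1 = 1 then (1 : L) else 0)).Local v)) (d' : Fin 2 → (UnitaryGroup.LocalRing L v)ˣ),
        glDiagonal 2 (UnitaryGroup.LocalRing L v) d' = ((y * γH * y⁻¹).1.val : GL (Fin 2) (UnitaryGroup.LocalRing L v)))
    (x : (cmDatum L 3 H').Local v) (hx : IsLocalNormPair L H' v γH x) :
    CompactSpace (Subgroup.centralizer ({x} : Set ((cmDatum L 3 H').Local v))) := by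
  obtain ⟨Q, u, hQ, hu, hu1⟩ := exists_normOne_eigenframe_of_isLocalNormPair_of_isRoot L v H' w hw hreg hsplit hell x hx
  exact compactSpace_centralizer_of_eigenframe_of_smul_eq L w hw H' hH' hdet x hQ hu hu1

end Literature.NumberTheory.Rogawski1990

end
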